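import Mathlib
import Summits.ResolutionOfSingularities.ResolutionOfSingularities.Theorems.SyzygyFlatteningDefs
import Literature.AlgebraicGeometry.Resolution.TranscendenceDefect
import HarnessLib

/-!
# Syzygy-flattening tower: the two ends of the induction on the residual transcendence degree

Stub `stub_residueTrdeg_cases` of the crux `HigherRankTermination` (line `birth`, base-change line,
wave 2).

Let `O ⊇ k` be a valuation ring of `K` with finite residual transcendence degree
`F = residueTrdeg k O = tr.deg_k κ(O)` (Temkin 2013, §2.1, the invariant `F`), and `v` a
real-valued valuation of `K` with ring `O`.

* `F = 0`: the residue field `κ(O)` is algebraic over `k` (`trdeg_eq_zero_iff`), so every `y ∈ O`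
  is, modulo `𝔪_O`, a root of the (non-zero) minimal polynomial of its residue — this is the
  route's `DimZero k O`.
* `F > 0`: `κ(O)` is transcendental over `k` (`trdeg_ne_zero_iff`); lifting a transcendental
  residue gives `ζ ∈ O` at which every non-zero `k`-polynomial is a unit of `O`, i.e. has
  `v`-value `1`.

Sources: Temkin 2013, §2.1 (the invariant `F`); the rest is folklore valuation theory
(Zariski–Samuel VI §3).
-/

noncomputable section

-- single-problem summit: the doubled namespace component is forced
set_option linter.dupNamespace false

open scoped NNReal

namespace Summit.ResolutionOfSingularities.ResolutionOfSingularities.Theorems.SyzygyFlattening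

open Literature.AlgebraicGeometry.Resolution IsLocalRing

/-- The residue map of a local `k`-algebra commutes with evaluation of `k`-polynomials.
[folklore] -/
theorem residueTrdeg_cases_residue_aeval {k R : Type*} [Field k] [CommRing R] [IsLocalRing R]
    [Algebra k R] (x : R) (f : Polynomial k) :
    residue R (Polynomial.aeval x f) = Polynomial.aeval (residue R x) f := by
  have h := Polynomial.aeval_algHom_apply (IsScalarTower.toAlgHom k R (ResidueField R)) x f
  simp only [IsScalarTower.coe_toAlgHom', ResidueField.algebraMap_eq] at h
  exact h.symm

/-- `F = 0`: the residue field is algebraic over `k`, so every element of `O` is, modulo `𝔪_O`, a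
root of the minimal polynomial of its residue (`DimZero`). [folklore] -/
theorem residueTrdeg_cases_dimZero {k K : Type} [Field k] [Field K] [Algebra k K]
    (O : ValuationSubring K) [Algebra k O] [IsScalarTower k O K]
    [Algebra.IsAlgebraic k (ResidueField O)] : DimZero k O := by
  intro y hy
  set r : ResidueField O := residue O ⟨y, hy⟩ with hr
  refine ⟨minpoly k r, minpoly.ne_zero (Algebra.IsAlgebraic.isAlgebraic r).isIntegral, ?_⟩
  have h1 : Polynomial.aeval y (minpoly k r) =
      ((Polynomial.aeval (⟨y, hy⟩ : O) (minpoly k r) : O) : K) :=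
    Polynomial.aeval_algebraMap_apply K (⟨y, hy⟩ : O) (minpoly k r)
  rw [h1, ← ValuationSubring.valuation_lt_one_iff, ← residue_eq_zero_iff,
    residueTrdeg_cases_residue_aeval, ← hr, minpoly.aeval]

/-- A non-zero `k`-polynomial evaluated at an element of `O` with transcendental residue is a
unit of `O`. [folklore] -/
theorem residueTrdeg_cases_isUnit_aeval {k K : Type} [Field k] [Field K] [Algebra k K]
    (O : ValuationSubring K) [Algebra k O] [IsScalarTower k O K] (ζ : O)
    (hζ : Transcendental k (residue O ζ)) {G : Polynomial k} (hG : G ≠ 0) :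
    IsUnit (Polynomial.aeval ζ G) := by
  rw [← residue_ne_zero_iff_isUnit, residueTrdeg_cases_residue_aeval]
  exact fun h0 => hζ ⟨G, hG, h0⟩

/-- For a valuation `v` with ring `O`, the units of `O` have `v`-value `1`. [folklore] -/
theorem residueTrdeg_cases_valuation_eq_one_of_isUnit {K : Type} [Field K]
    (O : ValuationSubring K) (v : Valuation K ℝ≥0) (hvO : ∀ x : K, v x ≤ 1 ↔ x ∈ O) {u : O}
    (hu : IsUnit u) : v (u : K) = 1 := by
  have hvInt : v.Integers O :=
    { hom_inj := Subtype.val_injective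
      map_le_one := fun x => (hvO x).2 x.2
      exists_of_le_one := fun r hr => ⟨⟨r, (hvO r).1 hr⟩, rfl⟩ }
  exact hvInt.isUnit_iff_valuation_eq_one.mp hu

/-- `F > 0`: some `ζ ∈ O` has residue transcendental over `k`, and then every non-zero
`k`-polynomial in `ζ` has `v`-value `1`. [folklore] -/
theorem residueTrdeg_cases_exists_transcendental {k K : Type} [Field k] [Field K] [Algebra k K]
    (O : ValuationSubring K) [Algebra k O] [IsScalarTower k O K]
    [Algebra.Transcendental k (ResidueField O)] (v : Valuation K ℝ≥0)
    (hvO : ∀ x : K, v x ≤ 1 ↔ x ∈ O) :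
    ∃ ζ : K, ζ ∈ O ∧ ∀ G : Polynomial k, G ≠ 0 → v (Polynomial.aeval ζ G) = 1 := by
  obtain ⟨z, hz⟩ := Algebra.Transcendental.transcendental (R := k) (A := ResidueField O)
  obtain ⟨ζ, rfl⟩ := residue_surjective z
  refine ⟨(ζ : K), ζ.2, fun G hG => ?_⟩
  have h1 : Polynomial.aeval (ζ : K) G = ((Polynomial.aeval ζ G : O) : K) :=
    Polynomial.aeval_algebraMap_apply K ζ G
  rw [h1]
  exact residueTrdeg_cases_valuation_eq_one_of_isUnit O v hvO
    (residueTrdeg_cases_isUnit_aeval O ζ hz hG)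

/-- **The two ends of the induction on `F = residueTrdeg k O`** (Temkin 2013, §2.1: the
dimension `F_{K/k} = tr.deg_k κ(O)` of a valued field over a trivially valued ground field).
With `F` finite and `v` a real-valued valuation with ring `O`: if `F = 0` the residue field is
algebraic over `k`, i.e. `O` is DIMENSION ZERO in the route's sense (`DimZero k O`: the minimal
polynomial of a residue has value `< 1` at the lift); if `F > 0` some `ζ ∈ O` has residue
transcendental over `k`, i.e. every non-zero `k`-polynomial in `ζ` is a unit (`v = 1`).
[cite: Temkin2013, Section 2.1 (p. 9)] -/
theorem stub_residueTrdeg_cases : ∀ (k K : Type) [Field k] [Field K] [Algebra k K]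
    (O : ValuationSubring K) (hk : ∀ c : k, algebraMap k K c ∈ O),
      residueTrdeg k O hk < Cardinal.aleph0 →
    ∀ (v : Valuation K ℝ≥0), (∀ x : K, v x ≤ 1 ↔ x ∈ O) →
      (Cardinal.toNat (residueTrdeg k O hk) = 0 → DimZero k O) ∧
      (0 < Cardinal.toNat (residueTrdeg k O hk) →
        ∃ ζ : K, ζ ∈ O ∧ ∀ G : Polynomial k, G ≠ 0 → v (Polynomial.aeval ζ G) = 1) := by
  intro k K _ _ _ O hk hfin v hvO
  letI : Algebra k O := algebraOfMem k O hk
  haveI : IsScalarTower k O K := isScalarTower_algebraOfMem k O hk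
  rw [residueTrdeg_eq O hk] at hfin ⊢
  obtain ⟨n, hn⟩ := Cardinal.lt_aleph0.1 hfin
  rw [hn, Cardinal.toNat_natCast]
  refine ⟨fun h0 => ?_, fun hpos => ?_⟩
  · subst h0
    haveI : Algebra.IsAlgebraic k (ResidueField O) := trdeg_eq_zero_iff.mp (by rw [hn]; rfl)
    exact residueTrdeg_cases_dimZero O
  · haveI : Algebra.Transcendental k (ResidueField O) :=
      trdeg_ne_zero_iff.mp (by rw [hn]; exact_mod_cast hpos.ne')
    exact residueTrdeg_cases_exists_transcendental O v hvO

end Summit.ResolutionOfSingularities.ResolutionOfSingularities.Theorems.SyzygyFlattening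

end
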